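import Summits.Ventures.PercRepro.C025ProfileThinTriangleD

/-!
# THE ROW `(q, q+1)` ON THIN MATROIDS WITH A 3-CIRCUIT — part E: THE THEOREM (night-3 g15)
`proofs/NIGHT3-G14-SIZE.md` §5e; parts A–D. **THEOREM** `profileIneq_thinTriangle` / `profileIneq_thinTriangle'` /
`hallIneq_thinTriangle`: for every `q ≥ 4` and every finite SIMPLE matroid (every set of `≤ 2` points has full rank) with a 3-circuit `K`
(`|K| = 3`, `ρ(K) = 2`) in which every rank-`q` set has at most `q + 1` points (THIN), the row `(q, q+1)` of C-032 and its Hall form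
(C-033) hold — for EVERY number of points `n`, below and above the simple rule's boundary `2n ≥ 5q − 1` of `C025ProfileThinRowF` and
beyond the one-short-circuit class 𝒞(q) of `C025ProfileOneCircuitB`. The certificate is the HYBRID RULE of part D with the cascade weights
of `C025ProfileCascadeArith` (`s_Q = 2/(3(q−1))`, `s_I = 1 + 1/f − s_Q`, `g_I = (q + 1 − (q−1) s_I)/2`, `g_J = (f + 1 − 2 g_I)/(f − 1)`,
`z_J = 2/3`, `z_F = 1`, `f = n − q − 1`) and the uniform inner payment `σ = 4/(3f)` when `f ≥ q`; when `f < q` nothing is demanding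
and the zero certificate closes the row (`profileIneq_of_small`). `profileIneq_thinTriangle_indep` / `hallIneq_thinTriangle_indep`: the
same with the hypotheses in Mathlib's `M.Indep` terms (every set of `≤ 2` points independent, `K` a dependent 3-set); instances
`profileIneq_six_seven_thinTriangle` (the row `(6, 7)` on every thin(6) simple matroid with a triangle, in particular at `n = 14`),
`profileIneq_seven_eight_thinTriangle`, `profileIneq_eight_nine_thinTriangle`.
-/
open scoped Matroid
namespace PercRepro
open Set Finset ThmH Staged
namespace ThinTriangle
variable {α : Type} [DecidableEq α] {M : Matroid α} [M.Finite]

/-- **The zero certificate**: when `|E| − q − 1 < q` no rank-`q` set is demanding (`ρ(E ∖ B) ≤ |E| − q < q + 1`). -/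
theorem profileIneq_of_small (q : ℕ) (hlt : (gr M).card - q - 1 < q) :
    Profile.ProfileIneq M q (q + 1) ∧ Profile.HallIneq M q (q + 1) := by
  have hdem : ∀ B ∈ Profile.Rq M q, Profile.price M q (q + 1) B ≤
      ∑ S ∈ (Shadow.levelSet M (q + 1)).filter (fun S => B ⊆ S), (fun _ _ => (0 : ℚ)) B S := by
    intro B hB
    rw [ThinRow.price_succ_eq]
    split_ifs with hd
    · exfalso
      rw [Profile.mem_Rq] at hB
      have hBq : rkN M B = q := rkN_eq_iff.mpr hB.2
      have h1 := OneCircuit.crk_add_card_le B hB.1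
      have h2 : q ≤ B.card := hBq ▸ rkN_le_card B
      omega
    · simp
  have hcap : ∀ S ∈ Shadow.levelSet M (q + 1),
      ∑ B ∈ (Profile.Rq M q).filter (fun B => B ⊆ S), (fun _ _ => (0 : ℚ)) B S ≤ 1 := by
    intro S _
    simp
  exact ⟨profileIneq_of_cert q (q + 1) (fun _ _ => (0 : ℚ)) hcap hdem,
    hallIneq_of_cert q (q + 1) (fun _ _ => (0 : ℚ)) (fun _ _ => le_refl 0) hcap hdem⟩

/-- The cascade weight `g_I = (q + 1 − (q − 1) s_I)/2 = 4/3 − (q − 1)/(2f)` is at most `4/3`. -/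
theorem cascade_gI_le {q f : ℕ} (hq : 2 ≤ q) (hf : 1 ≤ f) :
    ((q : ℚ) + 1 - ((q : ℚ) - 1) * (1 + 1 / (f : ℚ) - 2 / (3 * ((q : ℚ) - 1)))) / 2 ≤ 4 / 3 := by
  have hf0 : (f : ℚ) ≠ 0 := by
    have : (1 : ℚ) ≤ f := by exact_mod_cast hf
    linarith
  have hq1 : (q : ℚ) - 1 ≠ 0 := by
    have : (2 : ℚ) ≤ q := by exact_mod_cast hq
    linarith
  have e : ((q : ℚ) - 1) * (1 + 1 / (f : ℚ) - 2 / (3 * ((q : ℚ) - 1))) =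
      ((q : ℚ) - 1) + ((q : ℚ) - 1) / f - 2 / 3 := by
    field_simp
  rw [e]
  have h0 : 0 ≤ ((q : ℚ) - 1) / f := by
    apply div_nonneg
    · have : (2 : ℚ) ≤ q := by exact_mod_cast hq
      linarith
    · positivity
  linarith

/-- **THEOREM (thin + triangle)**: for every `q ≥ 4` and every finite simple matroid with a 3-circuit `K` in which every rank-`q` set
has at most `q + 1` points, the row `(q, q+1)` of (Π) and its Hall form hold, for EVERY `n` — the hybrid rule with the cascade weights
and `σ = 4/(3f)` when `f = n − q − 1 ≥ q`, the zero certificate otherwise. -/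
theorem profileIneq_thinTriangle (q : ℕ) (hq4 : 4 ≤ q)
    (hsimple : ∀ X ⊆ gr M, X.card ≤ 2 → rkN M X = X.card)
    (hthin : ∀ X ⊆ gr M, rkN M X = q → X.card ≤ q + 1)
    (K : Finset α) (hKg : K ⊆ gr M) (hK3 : K.card = 3) (hKrk : rkN M K = 2) :
    Profile.ProfileIneq M q (q + 1) ∧ Profile.HallIneq M q (q + 1) := by
  rcases Nat.lt_or_ge ((gr M).card - q - 1) q with hlt | hge
  · exact profileIneq_of_small q hlt
  · have hw := Cascade.cascade_weights (by omega : 2 ≤ q) hge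
    dsimp only at hw
    obtain ⟨h1, h2, h3, h4, h5, h6, h7, h8, h9⟩ := hw
    have hfpos : (0 : ℚ) < (((gr M).card - q - 1 : ℕ) : ℚ) := by exact_mod_cast (by omega : 0 < (gr M).card - q - 1)
    have hqf : (q : ℚ) ≤ (((gr M).card - q - 1 : ℕ) : ℚ) := by exact_mod_cast hge
    have hq0 : (0 : ℚ) < q := by exact_mod_cast (by omega : 0 < q)
    have hq4' : (4 : ℚ) ≤ q := by exact_mod_cast hq4
    -- `g_J ≤ 4/3` from the `J`-capacity `2/3 + q g_J ≤ q + 1`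
    have hgJ43 : ((((gr M).card - q - 1 : ℕ) : ℚ) + 1 -
        2 * (((q : ℚ) + 1 - ((q : ℚ) - 1) * (1 + 1 / (((gr M).card - q - 1 : ℕ) : ℚ) - 2 / (3 * ((q : ℚ) - 1)))) / 2)) /
        ((((gr M).card - q - 1 : ℕ) : ℚ) - 1) ≤ 4 / 3 := by
      by_contra hcon
      push Not at hcon
      nlinarith [h7, hcon, hq0, hq4']
    have hfcast : (((gr M).card - q - 2 : ℕ) : ℚ) = (((gr M).card - q - 1 : ℕ) : ℚ) - 1 := by
      have e : (gr M).card - q - 2 = (gr M).card - q - 1 - 1 := by omega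
      rw [e, Nat.cast_sub (by omega : 1 ≤ (gr M).card - q - 1)]
      push_cast
      ring
    refine profileIneq_thinTriangle_of_weights q hq4 hsimple hthin K hKg hK3 hKrk _ _ _ _
      (4 / (3 * (((gr M).card - q - 1 : ℕ) : ℚ))) h2 h1 h3 h4 (by positivity)
      (cascade_gI_le (by omega) (by omega)) hgJ43 hge (le_of_eq h5.symm) ?_ ?_ h7 h8 h9 ?_
    · rw [hfcast]
      exact le_of_eq h6.symm
    · have e : (((gr M).card - q - 1 : ℕ) : ℚ) * (4 / (3 * (((gr M).card - q - 1 : ℕ) : ℚ))) = 4 / 3 := by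
        field_simp
      rw [e]
    · have e : 2 * (q : ℚ) * (4 / (3 * (((gr M).card - q - 1 : ℕ) : ℚ))) =
          8 / 3 * ((q : ℚ) / (((gr M).card - q - 1 : ℕ) : ℚ)) := by
        field_simp
        ring
      rw [e]
      have : (q : ℚ) / (((gr M).card - q - 1 : ℕ) : ℚ) ≤ 1 := (div_le_one hfpos).mpr hqf
      linarith

/-- THEOREM (thin + triangle), the row alone. -/
theorem profileIneq_thinTriangle' (q : ℕ) (hq4 : 4 ≤ q)
    (hsimple : ∀ X ⊆ gr M, X.card ≤ 2 → rkN M X = X.card)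
    (hthin : ∀ X ⊆ gr M, rkN M X = q → X.card ≤ q + 1)
    (K : Finset α) (hKg : K ⊆ gr M) (hK3 : K.card = 3) (hKrk : rkN M K = 2) :
    Profile.ProfileIneq M q (q + 1) :=
  (profileIneq_thinTriangle q hq4 hsimple hthin K hKg hK3 hKrk).1

/-- THEOREM (thin + triangle), the Hall form (C-033). -/
theorem hallIneq_thinTriangle (q : ℕ) (hq4 : 4 ≤ q)
    (hsimple : ∀ X ⊆ gr M, X.card ≤ 2 → rkN M X = X.card)
    (hthin : ∀ X ⊆ gr M, rkN M X = q → X.card ≤ q + 1)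
    (K : Finset α) (hKg : K ⊆ gr M) (hK3 : K.card = 3) (hKrk : rkN M K = 2) :
    Profile.HallIneq M q (q + 1) :=
  (profileIneq_thinTriangle q hq4 hsimple hthin K hKg hK3 hKrk).2

/-- **THEOREM (thin + triangle), independence form**: `q ≥ 4`, every set of `≤ 2` points independent, `K ⊆ E` a dependent 3-set,
every rank-`q` set with `≤ q + 1` points ⇒ the row `(q, q+1)` of (Π) and its Hall form. -/
theorem profileIneq_thinTriangle_indep (q : ℕ) (hq4 : 4 ≤ q)
    (hsimple : ∀ T ⊆ M.E, T.encard ≤ 2 → M.Indep T)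
    (hthin : ∀ X ⊆ gr M, rkN M X = q → X.card ≤ q + 1)
    (K : Finset α) (hKE : (K : Set α) ⊆ M.E) (hK3 : K.card = 3) (hKdep : ¬ M.Indep (K : Set α)) :
    Profile.ProfileIneq M q (q + 1) ∧ Profile.HallIneq M q (q + 1) := by
  have hKg : K ⊆ gr M := by
    intro k hk
    have : k ∈ ((gr M : Finset α) : Set α) := by rw [coe_gr]; exact hKE hk
    exact_mod_cast this
  have hsimple' : ∀ X ⊆ gr M, X.card ≤ 2 → rkN M X = X.card := by
    intro X hXg hXc
    have hXE : (X : Set α) ⊆ M.E := by rw [← coe_gr]; exact_mod_cast hXg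
    apply OneCircuit.rkN_eq_card_of_indep
    apply hsimple _ hXE
    rw [Set.encard_coe_eq_coe_finsetCard]
    exact_mod_cast hXc
  -- `ρ(K) = 2`: `K` is dependent (`≤ 2`) and `K ∖ {k}` is an independent pair (`≥ 2`)
  have hKrk : rkN M K = 2 := by
    have hle : rkN M K ≤ 2 := by
      by_contra h
      push Not at h
      have h3 : rkN M K = 3 := le_antisymm (hK3 ▸ rkN_le_card K) (by omega)
      apply hKdep
      rw [Matroid.indep_iff_eRk_eq_encard_of_finite K.finite_toSet, Set.encard_coe_eq_coe_finsetCard, hK3,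
        ← rkN_eq_iff, h3]
    obtain ⟨k, hk⟩ : K.Nonempty := Finset.card_pos.mp (by omega)
    have hKk : rkN M (K.erase k) = (K.erase k).card :=
      hsimple' _ ((Finset.erase_subset k K).trans hKg) (by rw [Finset.card_erase_of_mem hk]; omega)
    have hmono : rkN M (K.erase k) ≤ rkN M K := rkN_mono (Finset.erase_subset k K)
    rw [Finset.card_erase_of_mem hk, hK3] at hKk
    omega
  exact profileIneq_thinTriangle q hq4 hsimple' hthin K hKg hK3 hKrk

/-- THEOREM (thin + triangle), independence form, the row alone. -/
theorem profileIneq_thinTriangle_indep' (q : ℕ) (hq4 : 4 ≤ q)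
    (hsimple : ∀ T ⊆ M.E, T.encard ≤ 2 → M.Indep T)
    (hthin : ∀ X ⊆ gr M, rkN M X = q → X.card ≤ q + 1)
    (K : Finset α) (hKE : (K : Set α) ⊆ M.E) (hK3 : K.card = 3) (hKdep : ¬ M.Indep (K : Set α)) :
    Profile.ProfileIneq M q (q + 1) :=
  (profileIneq_thinTriangle_indep q hq4 hsimple hthin K hKE hK3 hKdep).1

/-- THEOREM (thin + triangle), independence form, the Hall form. -/
theorem hallIneq_thinTriangle_indep (q : ℕ) (hq4 : 4 ≤ q)
    (hsimple : ∀ T ⊆ M.E, T.encard ≤ 2 → M.Indep T)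
    (hthin : ∀ X ⊆ gr M, rkN M X = q → X.card ≤ q + 1)
    (K : Finset α) (hKE : (K : Set α) ⊆ M.E) (hK3 : K.card = 3) (hKdep : ¬ M.Indep (K : Set α)) :
    Profile.HallIneq M q (q + 1) :=
  (profileIneq_thinTriangle_indep q hq4 hsimple hthin K hKE hK3 hKdep).2

/-- The row `(6, 7)` on every thin(6) simple matroid with a triangle — in particular at `n = 14`, where the simple rule fails. -/
theorem profileIneq_six_seven_thinTriangle (hsimple : ∀ T ⊆ M.E, T.encard ≤ 2 → M.Indep T)
    (hthin : ∀ X ⊆ gr M, rkN M X = 6 → X.card ≤ 7)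
    (K : Finset α) (hKE : (K : Set α) ⊆ M.E) (hK3 : K.card = 3) (hKdep : ¬ M.Indep (K : Set α)) :
    Profile.ProfileIneq M 6 7 :=
  profileIneq_thinTriangle_indep' 6 (by norm_num) hsimple hthin K hKE hK3 hKdep

/-- The row `(7, 8)` on every thin(7) simple matroid with a triangle. -/
theorem profileIneq_seven_eight_thinTriangle (hsimple : ∀ T ⊆ M.E, T.encard ≤ 2 → M.Indep T)
    (hthin : ∀ X ⊆ gr M, rkN M X = 7 → X.card ≤ 8)
    (K : Finset α) (hKE : (K : Set α) ⊆ M.E) (hK3 : K.card = 3) (hKdep : ¬ M.Indep (K : Set α)) :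
    Profile.ProfileIneq M 7 8 :=
  profileIneq_thinTriangle_indep' 7 (by norm_num) hsimple hthin K hKE hK3 hKdep

/-- The row `(8, 9)` on every thin(8) simple matroid with a triangle. -/
theorem profileIneq_eight_nine_thinTriangle (hsimple : ∀ T ⊆ M.E, T.encard ≤ 2 → M.Indep T)
    (hthin : ∀ X ⊆ gr M, rkN M X = 8 → X.card ≤ 9)
    (K : Finset α) (hKE : (K : Set α) ⊆ M.E) (hK3 : K.card = 3) (hKdep : ¬ M.Indep (K : Set α)) :
    Profile.ProfileIneq M 8 9 :=
  profileIneq_thinTriangle_indep' 8 (by norm_num) hsimple hthin K hKE hK3 hKdep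

end ThinTriangle
end PercRepro
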